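import Summits.ValiantsHypothesis.ValiantsHypothesis.Theorems.SymPencilPerFourToricLever

/-!
# Route `SymPencil` — perm-isotropic matrices and subspaces lie in a row, a column, or a
# `2 × 2` block (`--supports` stmt-ValiantsHypothesis-5674 `SdcSuperquadratic`; structural brick
# for the size-`27` cell `(11, 5, 4)`, Case B3 at dimension `5`)

A matrix (or a subspace of matrices) is *perm-isotropic* if all its `2 × 2` subpermanents
`x_{ij} x_{kl} + x_{il} x_{kj}` (`i ≠ k`, `j ≠ l`) vanish.  `SymPencilPerFourBlocksThree` showed
that a `3`-dimensional perm-isotropic subspace lies in one row or one column; at dimension `2`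
there is a third possibility, the ruling planes `span {E_{bj} + λE_{cj}, E_{bl} − λE_{cl}}`,
`span {E_{bj} + κE_{bl}, E_{cj} − κE_{cl}}` of a `2 × 2` block (the two rulings of the split
quadric `ps′ + qr = 0`).  This file proves the dimension-free envelope statement:

**Theorem** (`supp_row_or_col_or_block`, single matrix; `row_or_col_or_block_of_perm_two`,
subspaces).  Over a field of characteristic `0`, a perm-isotropic matrix / subspace of `K^{4×4}`
is supported in ONE ROW, or in ONE COLUMN, or in a `2 × 2` BLOCK `{b, c} × {j, l}`.

Proof: two non-zero rows of a perm-isotropic matrix are perm-orthogonal, hence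
(`SymPencilPerFourToricLever.support_pair_of_perm_orth`) supported on a common pair `{k, l}` with
`x_{bk} x_{cl} + x_{bl} x_{ck} = 0`; if `x_{bl} = 0` every row is supported on the column `k`,
otherwise a third non-zero row would be twisted-proportional to both and the `2 × 2`
subpermanent of rows `c, d` would be `−2 λ μ x_{bk} x_{bl} ≠ 0`.  The subspace version follows by
applying this to a generic element (`exists_forall_ne_zero`: over an infinite field a subspace has
an element outside finitely many hyperplanes not containing it).  Use (crux workfile
`Cruxes/SdcSuperquadratic/TORIC-SIX.md` §X (d)): with `SymPencilPerFourZeroCellStructure`, in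
Case B3 at dimension `5` the `2`-dimensional row-kernel `W₀` is a row plane (→ the two-row spaces
`V(L)`, bricks `…RowPair*NoJoint`), a column plane (→ the cross space `V₅×`,
`…CrossPairNoJoint`), or a ruling plane of a `2 × 2` block (killed by per-direction counting).

Honest framing: a structural brick; `27 ≤ sdc(per₄) ≤ 29` unchanged, the crux `SdcSuperquadratic`
and `VP ≠ VNP` untouched.  No definitions, no named facts. [folklore]
-/

noncomputable section

-- single-conjunct layout: Sub = Summit, duplicated namespace component intended
set_option linter.dupNamespace false

namespace Summit.ValiantsHypothesis.ValiantsHypothesis.Theorems.SymPencilPerFourPermIsotropicPlanes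

open Module
open Summit.ValiantsHypothesis.ValiantsHypothesis.Theorems.SymPencilPerFourToricLever

variable {K : Type*} [Field K]

/-- **Generic element**: over an infinite field, if none of finitely many linear functionals
vanishes identically on a subspace `P`, some element of `P` is outside all their kernels.
[folklore] -/
theorem exists_forall_ne_zero [Infinite K] {M : Type*} [AddCommGroup M] [Module K M]
    (P : Submodule K M) {ι : Type*} (T : Finset ι) (f : ι → M →ₗ[K] K)
    (hT : ∀ i ∈ T, ∃ x ∈ P, f i x ≠ 0) : ∃ z ∈ P, ∀ i ∈ T, f i z ≠ 0 := by
  classical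
  induction T using Finset.induction_on with
  | empty => exact ⟨0, P.zero_mem, fun i hi => absurd hi (Finset.notMem_empty i)⟩
  | @insert a T haT ih =>
    obtain ⟨z, hz, hzT⟩ := ih fun i hi => hT i (Finset.mem_insert_of_mem hi)
    obtain ⟨w, hw, hwa⟩ := hT a (Finset.mem_insert_self a T)
    let bad : Finset K := (insert a T).image fun i => -(f i z) / f i w
    obtain ⟨t, ht⟩ := Infinite.exists_notMem_finset bad
    refine ⟨z + t • w, P.add_mem hz (P.smul_mem t hw), fun i hi h0 => ?_⟩
    rw [map_add, map_smul, smul_eq_mul] at h0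
    by_cases hfw : f i w = 0
    · rw [hfw, mul_zero, add_zero] at h0
      rcases Finset.mem_insert.1 hi with rfl | hi'
      · exact hwa hfw
      · exact hzT i hi' h0
    · apply ht
      refine Finset.mem_image.2 ⟨i, hi, ?_⟩
      field_simp
      linear_combination -h0

/-- **A perm-isotropic matrix is supported in a row, a column, or a `2 × 2` block.** [folklore] -/
theorem supp_row_or_col_or_block [CharZero K] (x : Fin 4 × Fin 4 → K)
    (hx : ∀ i k j l : Fin 4, i ≠ k → j ≠ l → x (i, j) * x (k, l) + x (i, l) * x (k, j) = 0) :
    (∃ q : Fin 4, ∀ i j : Fin 4, i ≠ q → x (i, j) = 0) ∨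
    (∃ c₀ : Fin 4, ∀ i j : Fin 4, j ≠ c₀ → x (i, j) = 0) ∨
    (∃ b c j l : Fin 4, b ≠ c ∧ j ≠ l ∧ (∀ i m : Fin 4, i ≠ b → i ≠ c → x (i, m) = 0) ∧
      (∀ i m : Fin 4, m ≠ j → m ≠ l → x (i, m) = 0)) := by
  classical
  by_cases hrow : ∃ q : Fin 4, ∀ i j : Fin 4, i ≠ q → x (i, j) = 0
  · exact Or.inl hrow
  right
  push Not at hrow
  -- two distinct non-zero rows `b, c`
  obtain ⟨b, j₀, -, hbj₀⟩ := hrow 0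
  obtain ⟨c, m₀, hcb, hcm₀⟩ := hrow b
  -- perm-orthogonality of two rows of `x`
  have horth : ∀ p q : Fin 4, p ≠ q → ∀ l l' : Fin 4, l ≠ l' →
      x (p, l) * x (q, l') + x (p, l') * x (q, l) = 0 := fun p q hpq l l' hll' => hx p q l l' hpq hll'
  have hne : ∀ p m : Fin 4, x (p, m) ≠ 0 → (fun l => x (p, l)) ≠ 0 := fun p m h h0 =>
    h (by have := congr_fun h0 m; exact this)
  obtain ⟨k, l, hkl, hbk, hck, hrest, hrel⟩ :=
    support_pair_of_perm_orth (fun l => x (b, l)) (fun l => x (c, l)) (hne b j₀ hbj₀) (hne c m₀ hcm₀)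
      (horth b c (Ne.symm hcb))
  by_cases hbl : x (b, l) = 0
  · -- COLUMN `k`
    refine Or.inl ⟨k, fun i j hjk => ?_⟩
    -- row `b` is supported on `{k}`
    have hbrow : ∀ m, m ≠ k → x (b, m) = 0 := fun m hmk => by
      by_cases hml : m = l
      · rw [hml]; exact hbl
      · exact (hrest m hmk hml).1
    by_cases hib : i = b
    · rw [hib]; exact hbrow j hjk
    by_cases hi0 : (fun m => x (i, m)) = 0
    · exact congr_fun hi0 j
    obtain ⟨k', l', hk'l', hbk', hik', hrest', hrel'⟩ :=
      support_pair_of_perm_orth (fun l => x (b, l)) (fun l => x (i, l)) (hne b j₀ hbj₀) hi0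
        (horth b i (Ne.symm hib))
    have hk' : k' = k := by
      by_contra h
      exact hbk' (hbrow k' h)
    subst hk'
    have hil' : x (i, l') = 0 := by
      have h1 : x (b, l') = 0 := hbrow l' (Ne.symm hk'l')
      rw [h1, zero_mul, add_zero] at hrel'
      exact (mul_eq_zero.1 hrel').resolve_left hbk
    by_cases hjl' : j = l'
    · rw [hjl']; exact hil'
    · exact (hrest' j hjk hjl').2
  · -- BLOCK `{b, c} × {k, l}`
    have hcl : x (c, l) ≠ 0 := by
      intro h0
      rw [h0, mul_zero, zero_add] at hrel
      exact hbl ((mul_eq_zero.1 hrel).resolve_right hck)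
    have hrows : ∀ i, i ≠ b → i ≠ c → ∀ m, x (i, m) = 0 := by
      intro i hib hic
      have R1 := horth b i (Ne.symm hib) k l hkl
      have R2 := horth c i (Ne.symm hic) k l hkl
      have h2 : (2 : K) * (x (b, k) * x (c, l)) ≠ 0 :=
        mul_ne_zero two_ne_zero (mul_ne_zero hbk hcl)
      have hil : x (i, l) = 0 := by
        have e : (2 : K) * (x (b, k) * x (c, l)) * x (i, l) = 0 := by
          linear_combination x (c, l) * R1 - x (b, l) * R2 + x (i, l) * hrel
        exact (mul_eq_zero.1 e).resolve_left h2
      have hik : x (i, k) = 0 := by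
        have e : (2 : K) * (x (b, k) * x (c, l)) * x (i, k) = 0 := by
          linear_combination -(x (c, k) * R1) + x (b, k) * R2 + x (i, k) * hrel
        exact (mul_eq_zero.1 e).resolve_left h2
      intro m
      by_cases hi0 : (fun m => x (i, m)) = 0
      · exact congr_fun hi0 m
      exfalso
      obtain ⟨k', l', -, hbk', hik', -, -⟩ :=
        support_pair_of_perm_orth (fun l => x (b, l)) (fun l => x (i, l)) (hne b j₀ hbj₀) hi0
          (horth b i (Ne.symm hib))
      by_cases hk'k : k' = k
      · exact hik' (by rw [hk'k]; exact hik)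
      by_cases hk'l : k' = l
      · exact hik' (by rw [hk'l]; exact hil)
      exact hbk' (hrest k' hk'k hk'l).1
    refine Or.inr ⟨b, c, k, l, Ne.symm hcb, hkl, fun i m hib hic => hrows i hib hic m,
      fun i m hmk hml => ?_⟩
    by_cases hib : i = b
    · rw [hib]; exact (hrest m hmk hml).1
    by_cases hic : i = c
    · rw [hic]; exact (hrest m hmk hml).2
    exact hrows i hib hic m

/-- **A perm-isotropic subspace is supported in a row, a column, or a `2 × 2` block**
(any dimension; characteristic `0`). [folklore] -/
theorem row_or_col_or_block_of_perm_two [CharZero K] (P : Submodule K (Fin 4 × Fin 4 → K))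
    (hB : ∀ y ∈ P, ∀ i k j l : Fin 4, i ≠ k → j ≠ l →
      y (i, j) * y (k, l) + y (i, l) * y (k, j) = 0) :
    (∃ q : Fin 4, ∀ x ∈ P, ∀ i j : Fin 4, i ≠ q → x (i, j) = 0) ∨
    (∃ c₀ : Fin 4, ∀ x ∈ P, ∀ i j : Fin 4, j ≠ c₀ → x (i, j) = 0) ∨
    (∃ b c j l : Fin 4, b ≠ c ∧ j ≠ l ∧ (∀ x ∈ P, ∀ i m : Fin 4, i ≠ b → i ≠ c → x (i, m) = 0) ∧
      (∀ x ∈ P, ∀ i m : Fin 4, m ≠ j → m ≠ l → x (i, m) = 0)) := by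
  classical
  haveI : Infinite K := Infinite.of_injective _ Nat.cast_injective
  -- a generic element `z`: non-zero at every cell where `P` is not identically zero
  let T : Finset (Fin 4 × Fin 4) := Finset.univ.filter fun p => ∃ x ∈ P, x p ≠ 0
  obtain ⟨z, hz, hzT⟩ := exists_forall_ne_zero P T (fun p => LinearMap.proj p) fun p hp => by
    obtain ⟨x, hx, hxp⟩ := (Finset.mem_filter.1 hp).2
    exact ⟨x, hx, hxp⟩
  have key : ∀ p : Fin 4 × Fin 4, z p = 0 → ∀ x ∈ P, x p = 0 := by
    intro p hp x hx
    by_contra hxp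
    have hpT : p ∈ T := Finset.mem_filter.2 ⟨Finset.mem_univ p, x, hx, hxp⟩
    exact hzT p hpT hp
  rcases supp_row_or_col_or_block z (hB z hz) with ⟨q, hq⟩ | ⟨c₀, hc₀⟩ | ⟨b, c, j, l, hbc, hjl, hr, hc⟩
  · exact Or.inl ⟨q, fun x hx i j' hiq => key (i, j') (hq i j' hiq) x hx⟩
  · exact Or.inr (Or.inl ⟨c₀, fun x hx i j' hj => key (i, j') (hc₀ i j' hj) x hx⟩)
  · exact Or.inr (Or.inr ⟨b, c, j, l, hbc, hjl,
      fun x hx i m hib hic => key (i, m) (hr i m hib hic) x hx,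
      fun x hx i m hmj hml => key (i, m) (hc i m hmj hml) x hx⟩)

end Summit.ValiantsHypothesis.ValiantsHypothesis.Theorems.SymPencilPerFourPermIsotropicPlanes

end
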